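import Summits.QuantumFields.YangMills.Theorems.TubeZeroFreeChannel.Negative.AxisBlocking
import Summits.QuantumFields.YangMills.Theorems.ComplexCouplingChannelTubeZeroFreeChannelStubDominanceOfZeroFree
import Literature.Analysis.Complex.HarnackHalfPlane

/-!
# `TubeZeroFreeChannel` (stmt-QuantumFields-18841) — negative lemma: the crux fails under the
# flux-vacua two-rate hypothesis (line `FluxPinchSketch`, card `flux-vacua-harnack-pinch`)

Lead prover-line-stmt-QuantumFields-18841-a1-0 (crux protocol, MODE LINE), 2026-08-17.

What is PROVED here (kernel-checked, no `sorry`): the implication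

  `FluxVacuaTwoRate → ¬ TubeZeroFreeChannel`

(`tubeZeroFreeChannel_false_of_fluxVacuaTwoRate`), where `FluxVacuaTwoRate` (a `def … : Prop` of
this file, the ONE physics hypothesis) says: for SOME admissible `(G, r)` — intended `G = SO(3)`
(any compact simple `G` with `π₁(G) ≠ 0`), any faithful `r` — cofinally in `β` and for every `δ > 0`
there is a disc `B(β, R)`, `R ≤ δ`, on which for all large cross-sections `L` the tube partition
functions `(boxSystem r.ρ ![L,L,L,t]).partZ univ` (`= boxZ r · L t`, the crux's `Zc`) are a dominated
exponential sum of `k + 2` holomorphic zero-free levels (the vacuum and the 't Hooft magnetic-flux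
vacua, then a gap `θ_L < 1`), the vacuum `λ₀ = λ_{j₀} e^{g_L}` strictly top at `β`, with the
TWO-RATE property `Re g_L(x) / Re g_L(β) → 0` (`L → ∞`) at a real `x`, `|x − β| < R/2` — the typed
form of the flux-energy splitting `ΔE_m(β, L) ≍ L e^{−ρ(β)L²}` (confinement; Kovács–Tomboulis,
PRL 85 (2000) 704, case (c)) or `≍ e^{−M(β)L}` (ℤ₂-monopole world-line tunnelling) with a
`β`-dependent rate.

Mechanism.  Harnack's inequality for the half-plane-valued maps `i·g_L` (`exists_re_nonpos_of_twoRate`,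
from the tree's `Complex.im_apply_ge_harnack`) forbids two rates for holomorphic `g_L` with
`Re g_L > 0` on a FIXED disc: so `Re g_L(z₀) ≤ 0` at some `z₀ ∈ B(β, R)` for cofinally many `L`, i.e.
`‖λ₀(z₀)‖ ≤ ‖λ_{j₀}(z₀)‖`.  If the crux held, `B(β, δ) ⊇ B(β, R)` would be uniformly zero-free
(`tubeZeroFreeChannel_iff_boxZ`), and the landed stub A of the line
(`stub_dominance_of_zeroFree`, p151004: zero-freeness of a dominated exponential sum for all large
`t` forces the centre-dominant level to dominate the whole disc — Montel/Borel–Carathéodory, the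
converse half of Beraha–Kahane–Weiss) gives `‖λ_{j₀}‖ ≤ ‖λ₀‖` on `B(β, R)`; the maximum modulus
principle (`norm_eq_const_mul_of_dominated_touch`) then makes `‖λ_{j₀}‖ = 1·‖λ₀‖` on the disc,
which the non-proportionality clause excludes.

STATUS of the hypothesis (why this is a negative LEMMA, not a refutation): `FluxVacuaTwoRate`
requires (i) `L`-uniform complex-coupling spectral control of the `SO(3)` transfer matrix at WEAK
coupling (levels holomorphic on an `L`-independent disc) and (ii) a two-sided, `β`-dependent bound on
an `e^{−ρ(β)L²}`-small splitting — confinement-grade input.  Literature reconnaissance of this seat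
(recon-flux.md, attached to the item): 't Hooft NPB 153 (1979) (duality exact, asymptotics
heuristic), Mack–Petkova 1979/80 and Borgs–Seiler CMP 91 (1983) (all-`β` inequalities; weak coupling
only at finite `N_t`), Tomboulis–Yaffe CMP 100 (1985) (finite temperature), Kovács–Tomboulis 2000 and
de Forcrand–Jahn 2003 (numerics), Tomboulis arXiv:0707.2179 (claimed all-`β` confinement; gap
identified by Ito–Seiler arXiv:0711.4930, 0803.3019 — "remains an important open question",
Chatterjee arXiv:1803.01950 Problem 4.1).  Nothing in print proves (i) or (ii) at large `β` in `d = 4`.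
-/

set_option autoImplicit false

noncomputable section

namespace Summit.QuantumFields.YangMills.Theorems.TubeZeroFreeChannel.Negative

open scoped BigOperators Topology
open MeasureTheory Filter Metric
open Literature.MathematicalPhysics.QuantumFieldTheory (LatticeRep IsCompactSimpleLieGroup boxSystem)
open Summit.QuantumFields.YangMills.Theses.ComplexCouplingChannel (TubeZeroFreeChannel)

/-! ## The physics hypothesis -/

/-- **Flux-vacua two-rate hypothesis** (`H` of the negative lemma; the registered stub
`stub_fluxVacuaTwoRate` of line `FluxPinchSketch`, verbatim).  For SOME admissible `(G, r)`
(intended: `SO(3)` with any faithful unitary `r`; more generally compact simple `G` with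
`π₁(G) ≠ 0`), cofinally in `β` and for every `δ > 0`: a radius `R ≤ δ`, a real point `x` with
`|x − β| < R/2`, multiplicities `n`, a flux index `j₀ ≠ 0` and, for all large `L`, holomorphic
zero-free levels `lam L j` on `ball β R` with envelope `Λ L`, pairwise non-proportional moduli,
dominating the tube partition functions `(boxSystem r.ρ ![L,L,L,t]).partZ univ` for all `t ≥ 1` up
to `C_L (θ_L Λ L)^t` (`θ_L < 1`), the vacuum `lam L 0` strictly top at `β` and equal to
`lam L j₀ · exp (g L)` with `g L` holomorphic, `Re g L β > 0`; and the TWO-RATE property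
`Re g L x / Re g L β → 0` as `L → ∞` (near-degenerate 't Hooft-flux vacua split at a `β`-dependent
exponential rate: `ΔE_m ≍ L e^{−ρ(β)L²}` or `e^{−M(β)L}`).  Open-problem grade at weak coupling (see
the module docstring); it enters as a hypothesis, never as a citation. -/
def FluxVacuaTwoRate : Prop :=
    ∃ (G : Type) (_ : Group G) (_ : TopologicalSpace G) (_ : IsTopologicalGroup G)
      (_ : CompactSpace G) (_ : MeasurableSpace G) (_ : BorelSpace G),
      IsCompactSimpleLieGroup G ∧ ∃ r : LatticeRep G, ∀ b : ℝ, ∃ β : ℝ, b ≤ β ∧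
        ∀ δ : ℝ, 0 < δ → ∃ (R x : ℝ) (k : ℕ) (n : Fin (k + 2) → ℕ) (j₀ : Fin (k + 2))
          (lam : ℕ → Fin (k + 2) → ℂ → ℂ) (Λ : ℕ → ℂ → ℝ) (g : ℕ → ℂ → ℂ) (L₀ : ℕ),
          0 < R ∧ R ≤ δ ∧ |x - β| < R / 2 ∧ (∀ j, 0 < n j) ∧ j₀ ≠ 0 ∧
          (∀ L : ℕ, L₀ ≤ L →
            (∀ j, DifferentiableOn ℂ (lam L j) (ball (β : ℂ) R)) ∧
            (∀ j, ∀ z ∈ ball (β : ℂ) R, lam L j z ≠ 0 ∧ ‖lam L j z‖ ≤ Λ L z) ∧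
            (∀ z ∈ ball (β : ℂ) R, ∃ j, ‖lam L j z‖ = Λ L z) ∧
            (∀ i j, i ≠ j → ¬ ∃ a : ℝ, ∀ z ∈ ball (β : ℂ) R, ‖lam L i z‖ = a * ‖lam L j z‖) ∧
            (∃ C θ : ℝ, 0 ≤ C ∧ 0 ≤ θ ∧ θ < 1 ∧ ∀ z ∈ ball (β : ℂ) R, ∀ t : ℕ, 1 ≤ t →
              ‖(boxSystem r.ρ (![L, L, L, t] : Fin 4 → ℕ)).partZ Finset.univ z
                - ∑ j, (n j : ℂ) * (lam L j z) ^ t‖ ≤ C * (θ * Λ L z) ^ t) ∧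
            (∀ j, j ≠ 0 → ‖lam L j (β : ℂ)‖ < ‖lam L 0 (β : ℂ)‖) ∧
            DifferentiableOn ℂ (g L) (ball (β : ℂ) R) ∧ 0 < (g L (β : ℂ)).re ∧
            (∀ z ∈ ball (β : ℂ) R, lam L 0 z = lam L j₀ z * Complex.exp (g L z))) ∧
          Tendsto (fun L => (g L x).re / (g L β).re) atTop (𝓝 0)

/-! ## The Harnack two-rate pinch -/

/-- **Two rates are incompatible with positivity on a fixed disc (Harnack).**  If holomorphic
functions `g_L` on `B(β, R)` have `Re g_L(β) > 0` eventually but `Re g_L(x) / Re g_L(β) → 0` along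
`L` at a fixed real point `x` with `|x − β| < R/2`, then for cofinally many `L` some point of the
disc has `Re g_L ≤ 0`: otherwise Harnack's inequality for the upper-half-plane-valued map `i·g_L`
(`Complex.im_apply_ge_harnack`) would give `Re g_L(x) ≥ Re g_L(β)/3`. [folklore] -/
theorem exists_re_nonpos_of_twoRate {g : ℕ → ℂ → ℂ} {β x R : ℝ} (hR : 0 < R)
    (hx : |x - β| < R / 2)
    (hd : ∀ᶠ L in atTop, DifferentiableOn ℂ (g L) (ball (β : ℂ) R))
    (hpos : ∀ᶠ L in atTop, 0 < (g L β).re)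
    (hrate : Tendsto (fun L => (g L x).re / (g L β).re) atTop (𝓝 0)) :
    ∃ᶠ L in atTop, ∃ z ∈ ball (β : ℂ) R, (g L z).re ≤ 0 := by
  by_contra hcontra
  rw [Filter.not_frequently] at hcontra
  have hsmall : ∀ᶠ L in atTop, (g L x).re / (g L β).re < 1 / 3 :=
    hrate.eventually (gt_mem_nhds (by norm_num))
  obtain ⟨L, hL4⟩ := (((hd.and hpos).and hcontra).and hsmall).exists
  obtain ⟨⟨⟨hdL, hposL⟩, hcL⟩, hsL⟩ := hL4
  -- positivity of `Re g_L` on the whole disc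
  have hposall : ∀ z ∈ ball (β : ℂ) R, 0 < (g L z).re := by
    intro z hz
    by_contra hle
    exact hcL ⟨z, hz, not_lt.mp hle⟩
  -- Harnack for `Q = I * g L` (`im Q = re g`)
  set Q : ℂ → ℂ := fun z => Complex.I * g L z with hQ
  have hQd : DifferentiableOn ℂ Q (ball (β : ℂ) R) := hdL.const_mul Complex.I
  have hQim : ∀ z, (Q z).im = (g L z).re := by
    intro z; simp [hQ, Complex.mul_im]
  have hQpos : ∀ z ∈ ball (β : ℂ) R, 0 < (Q z).im := fun z hz => by
    rw [hQim]; exact hposall z hz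
  have hxball : (x : ℂ) ∈ ball (β : ℂ) R := by
    rw [Metric.mem_ball, dist_eq_norm, ← Complex.ofReal_sub, Complex.norm_real, Real.norm_eq_abs]
    linarith
  have hH := Complex.im_apply_ge_harnack hR hQd hQpos hxball
  rw [hQim, hQim] at hH
  -- the Harnack factor at distance `< R/2` is at least `1/3`
  have hdist : ‖(x : ℂ) - β‖ < R / 2 := by
    rw [← Complex.ofReal_sub, Complex.norm_real, Real.norm_eq_abs]; exact hx
  have hfac : (1 : ℝ) / 3 ≤ (R - ‖(x : ℂ) - (β : ℂ)‖) / (R + ‖(x : ℂ) - (β : ℂ)‖) := by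
    have hn : 0 ≤ ‖(x : ℂ) - (β : ℂ)‖ := norm_nonneg _
    rw [div_le_div_iff₀ (by norm_num) (by linarith)]
    linarith
  have hβpos : 0 < (g L (β : ℂ)).re := hposL
  have hge : (g L (β : ℂ)).re / 3 ≤ (g L (x : ℂ)).re := by
    calc (g L (β : ℂ)).re / 3 = (g L (β : ℂ)).re * (1 / 3) := by ring
      _ ≤ (g L (β : ℂ)).re * ((R - ‖(x : ℂ) - (β : ℂ)‖) / (R + ‖(x : ℂ) - (β : ℂ)‖)) :=
          mul_le_mul_of_nonneg_left hfac hβpos.le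
      _ ≤ (g L (x : ℂ)).re := hH
  have hratio : (1 : ℝ) / 3 ≤ (g L x).re / (g L β).re := by
    rw [le_div_iff₀ hβpos]
    linarith
  linarith

/-! ## Maximum modulus: domination plus one touching point makes two levels proportional -/

/-- If `l₁` is dominated in modulus by the zero-free `l₀` on a ball and touches it at one interior
point, then `‖l₁‖ = 1 · ‖l₀‖` on the whole ball (maximum modulus principle
`Complex.eqOn_of_isPreconnected_of_isMaxOn_norm` for `l₁ / l₀`). [folklore] -/
theorem norm_eq_const_mul_of_dominated_touch {l₀ l₁ : ℂ → ℂ} {c z₀ : ℂ} {R : ℝ}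
    (h₀ : DifferentiableOn ℂ l₀ (ball c R)) (h₁ : DifferentiableOn ℂ l₁ (ball c R))
    (hne : ∀ z ∈ ball c R, l₀ z ≠ 0) (hdom : ∀ z ∈ ball c R, ‖l₁ z‖ ≤ ‖l₀ z‖)
    (hz₀ : z₀ ∈ ball c R) (htouch : ‖l₀ z₀‖ ≤ ‖l₁ z₀‖) :
    ∃ a : ℝ, ∀ z ∈ ball c R, ‖l₁ z‖ = a * ‖l₀ z‖ := by
  set φ : ℂ → ℂ := fun z => l₁ z / l₀ z with hφ
  have hφd : DifferentiableOn ℂ φ (ball c R) := h₁.div h₀ hne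
  have hφle : ∀ z ∈ ball c R, ‖φ z‖ ≤ 1 := fun z hz => by
    rw [hφ, norm_div, div_le_one (norm_pos_iff.2 (hne z hz))]
    exact hdom z hz
  have hφz₀ : ‖φ z₀‖ = 1 := by
    refine le_antisymm (hφle z₀ hz₀) ?_
    rw [hφ, norm_div, le_div_iff₀ (norm_pos_iff.2 (hne z₀ hz₀)), one_mul]
    exact htouch
  have hmax : IsMaxOn (norm ∘ φ) (ball c R) z₀ := fun z hz => by
    simp only [Function.comp_apply, Set.mem_setOf_eq, hφz₀]
    exact hφle z hz
  have hconst := Complex.eqOn_of_isPreconnected_of_isMaxOn_norm (convex_ball c R).isPreconnected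
    isOpen_ball hφd hz₀ hmax
  refine ⟨1, fun z hz => ?_⟩
  have h1 : φ z = φ z₀ := hconst hz
  have h2 : l₁ z = φ z * l₀ z := by
    rw [hφ]; exact (div_mul_cancel₀ (l₁ z) (hne z hz)).symm
  rw [h2, norm_mul, h1, hφz₀]

/-! ## The negative lemma -/

/-- **`TubeZeroFreeChannel` is false under the flux-vacua two-rate hypothesis.**  From
`hP : FluxVacuaTwoRate` take the admissible `(G, r)`; if the crux held it would give `β₁`, and `hP` a
pinched `β ≥ β₁`; the crux's open `D ∋ β` contains a disc `B(β, δ)`, uniformly zero-free for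
`L ≥ L₁`, `t ≥ t₀(L)`; `hP` at this `δ` gives the levels on `B(β, R) ⊆ B(β, δ)` for `L ≥ L₀` and the
two-rate splitting `g_L`; Harnack (`exists_re_nonpos_of_twoRate`) gives `L ≥ max L₀ L₁` and
`z₀ ∈ B(β, R)` with `‖λ₀(z₀)‖ ≤ ‖λ_{j₀}(z₀)‖`; stub A (`stub_dominance_of_zeroFree`, fed with
zero-freeness for `t ≥ max t₀ 1` through the dictionary `boxZ_eq_partZ`) gives `‖λ_{j₀}‖ ≤ ‖λ₀‖` on
the disc; maximum modulus makes them proportional — excluded by `hP`. -/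
theorem tubeZeroFreeChannel_false_of_fluxVacuaTwoRate (hP : FluxVacuaTwoRate) :
    ¬ TubeZeroFreeChannel := by
  intro hT
  rw [tubeZeroFreeChannel_iff_boxZ] at hT
  obtain ⟨G, _, _, _, _, _, _, hG, r, hr⟩ := hP
  obtain ⟨β₁, hβ₁⟩ := hT G hG r
  obtain ⟨β, hb, hβ⟩ := hr β₁
  obtain ⟨D, hDo, -, hβD, -, L₁, hL₁⟩ := hβ₁ β hb 1 one_pos
  obtain ⟨δ, hδ, hball⟩ := Metric.isOpen_iff.mp hDo _ hβD
  obtain ⟨R, x, k, n, j₀, lam, Λ, g, L₀, hR, hRδ, hx, hn, hj₀, hL, hrate⟩ := hβ δ hδ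
  -- Harnack two-rate: `Re g_L ≤ 0` somewhere in the disc, for cofinally many `L`
  have hd : ∀ᶠ L in atTop, DifferentiableOn ℂ (g L) (ball (β : ℂ) R) :=
    eventually_atTop.2 ⟨L₀, fun L hLL => (hL L hLL).2.2.2.2.2.2.1⟩
  have hpos : ∀ᶠ L in atTop, 0 < (g L β).re :=
    eventually_atTop.2 ⟨L₀, fun L hLL => (hL L hLL).2.2.2.2.2.2.2.1⟩
  have hfreq := exists_re_nonpos_of_twoRate hR hx hd hpos hrate
  obtain ⟨L, hLge, z₀, hz₀, hgz₀⟩ := (frequently_atTop.1 hfreq) (max L₀ L₁)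
  have hLL₀ : L₀ ≤ L := le_trans (le_max_left _ _) hLge
  have hLL₁ : L₁ ≤ L := le_trans (le_max_right _ _) hLge
  obtain ⟨hdlam, hlam, henv, hnd, ⟨C, θ, hC, hθ, hθ1, hdom⟩, hstrict, -, -, hfac⟩ := hL L hLL₀
  -- at `z₀` the vacuum level is no longer strictly dominant: `‖λ₀‖ = ‖λ_{j₀}‖ e^{Re g} ≤ ‖λ_{j₀}‖`
  have hloss : ‖lam L 0 z₀‖ ≤ ‖lam L j₀ z₀‖ := by
    rw [hfac z₀ hz₀, norm_mul, Complex.norm_exp]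
    have h1 : Real.exp (g L z₀).re ≤ 1 := by
      rw [← Real.exp_zero]; exact Real.exp_le_exp.mpr hgz₀
    calc ‖lam L j₀ z₀‖ * Real.exp (g L z₀).re ≤ ‖lam L j₀ z₀‖ * 1 :=
          mul_le_mul_of_nonneg_left h1 (norm_nonneg _)
      _ = ‖lam L j₀ z₀‖ := mul_one _
  -- zero-freeness of the tubes of cross-section `L` on `ball β R ⊆ ball β δ ⊆ D` for `t ≥ max t₀ 1`
  obtain ⟨t₀, ht₀⟩ := hL₁ L hLL₁
  set Z : ℕ → ℂ → ℂ := fun t z =>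
    (boxSystem r.ρ (![L, L, L, t] : Fin 4 → ℕ)).partZ Finset.univ z with hZdef
  have hzf : ∀ t, max t₀ 1 ≤ t → ∀ z ∈ ball (β : ℂ) R, Z t z ≠ 0 := by
    intro t ht z hz
    have h := ht₀ t (le_trans (le_max_left _ _) ht) z (hball (ball_subset_ball hRδ hz))
    rwa [boxZ_eq_partZ] at h
  have hZd : ∀ t, max t₀ 1 ≤ t → DifferentiableOn ℂ (Z t) (ball (β : ℂ) R) := by
    intro t _
    have h := (differentiable_boxZ r L t).differentiableOn (s := ball (β : ℂ) R)
    refine h.congr fun z _ => ?_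
    simp only [hZdef, boxZ_eq_partZ]
  have hdom' : ∀ z ∈ ball (β : ℂ) R, ∀ t : ℕ, max t₀ 1 ≤ t →
      ‖Z t z - ∑ j, (n j : ℂ) * (lam L j z) ^ t‖ ≤ C * (θ * Λ L z) ^ t :=
    fun z hz t ht => hdom z hz t (le_trans (le_max_right _ _) ht)
  -- STUB A (landed): the vacuum dominates every level on the whole disc
  have hdomAll := stub_dominance_of_zeroFree Z (β : ℂ) R k (lam L) n (Λ L) C θ (max t₀ 1) hR hn
    hC hθ hθ1 hZd hdlam hlam henv hnd hdom' hstrict hzf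
  -- maximum modulus: `λ_{j₀}` and `λ₀` are proportional in modulus — excluded
  obtain ⟨a, ha⟩ := norm_eq_const_mul_of_dominated_touch (hdlam 0) (hdlam j₀)
    (fun z hz => (hlam 0 z hz).1) (fun z hz => hdomAll j₀ z hz) hz₀ hloss
  exact hnd j₀ 0 hj₀ ⟨a, ha⟩

end Summit.QuantumFields.YangMills.Theorems.TubeZeroFreeChannel.Negative
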